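/-
Copyright (c) 2026. All rights reserved.
Released under Apache 2.0 license as described in the file LICENSE.
Authors: abc-iut cell, wave-2 seat abc-iut-L3-t11 (proof-only; the named fact `EdgeLikeDistinct` of
abc-iut-L3-d2's `TemperedEdgeLikeDistinct.lean` from Thm 3.7 (i)(ii)(iii)).
-/
import Literature.AnabelianGeometry.SemiGraphs.TemperedEdgeLikeDistinct
import Literature.AnabelianGeometry.SemiGraphs.TemperedEdgeLikeDistinctProofs
import HarnessLib

/-!
# [SemiAnbd] Thm 3.7: `EdgeLikeDistinct` from (i), (ii), (iii)

Mochizuki, *Semi-graphs of anabelioids*, Publ. RIMS **42** (2006) [MochizukiSemiAnbd2006], Thm 3.7 (iii)/(iv)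
p. 41 and the proof of Cor 3.9 p. 42. PROOF-ONLY wrapper: abc-iut-L3-d2's named fact
`ProfiniteSemiGraph.EdgeLikeDistinct` (edge-like subgroups of distinct edges are not commensurable:
`L₂.relIndex L₁ = 0`) follows from Thm 3.7 (i) `VerticialInjective`, (ii) `VerticialDistinct`,
(iii) `CompactInVerticial` by `relIndex_edgeLike_eq_zero` (`TemperedEdgeLikeDistinctProofs.lean`).
No definitions.
-/

namespace Literature.AnabelianGeometry.SemiGraphs

namespace ProfiniteSemiGraph

universe u

/-- **`EdgeLikeDistinct` from Thm 3.7 (i), (ii), (iii).** [cite: MochizukiSemiAnbd2006, Thm 3.7(iv) p.41] -/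
theorem edgeLikeDistinct_of (hCV : CompactInVerticial.{u}) (hVD : VerticialDistinct.{u})
    (hVI : VerticialInjective.{u}) : EdgeLikeDistinct.{u} :=
  fun _ h𝒢 c _ _ _ _ hL₁ hL₂ hne => relIndex_edgeLike_eq_zero hCV hVD hVI h𝒢 c hne hL₁ hL₂

end ProfiniteSemiGraph

end Literature.AnabelianGeometry.SemiGraphs
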